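import Literature.NumberTheory.GaloisCohomology.PoitouTateSumTotallyComplex
import Literature.NumberTheory.EllipticCurves.LocalWeilPairingDuality
import Literature.NumberTheory.EllipticCurves.WeilPairingTateDual
import Literature.NumberTheory.EllipticCurves.LocalEulerCharacteristicTorsion
import Literature.NumberTheory.EllipticCurves.OrdinaryLocalCondition
import HarnessLib

/-!
# Route `KolyvaginRoadThree`, deciding crux `ZhangSharpFrameAtThreeHL` (item stmt-BirchSwinnertonDyer-19574):
# the Poitou–Tate SEE-SAW behind stub `stub_levelRaisingAtThree` — an isotropic subgroup of `H¹(K_v, E[p])`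
# is a LINE, and the image at `v` of global classes pairwise orthogonal away from `v` is isotropic
# (cell `bsd-stepL`, seat `bsd-stepL-koly` g13; `--supports stmt-BirchSwinnertonDyer-19574`, helper)

WHY THIS FILE. The registered METHOD skeleton of crux 19574 (v2x, `Cruxes/ZhangSharpFrameAtThreeHL/Lines/method2.lean`)
has the open stub `stub_levelRaisingAtThree` = W. Zhang's rank lowering (A1) on GOOD unipotent-admissible levels.
The ACCEL seat koly3a reduced its text to five local–global inputs (`Method2.stub_levelRaisingAtThree_v2w_of_localGlobal`,
p467211): (Cheb), (Equiv), (Line), (Trans) — local statements at ONE good prime — and (Iso), "the localisations at `q`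
of two classes of the `q`-relaxed level-`n` space are proportional", the one GLOBAL input (Zhang Prop. 5.4 ∕
Poitou–Tate; koly MEMO-v8 §5), which had no tree supplier. This file and its two siblings
(`…Method2IsoOrdinary.lean`, `…Method2Iso.lean`) make (Iso) — and (Line) — KERNEL THEOREMS modulo ONE local input
(H0) `#E[3]^{Γ_{K_w}} ≤ 3` at the place of every good unipotent-admissible prime, using ONLY proved tree theorems:
Tate's reciprocity law for totally complex `K` (`poitouTate_sum_localTatePairing_eq_zero_of_isTotallyComplex`), its
Weil transport (`sum_inv_weilCupProduct_localization_eq_zero`), local Tate duality for `E[n]`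
(`eq_zero_of_forall_weilCupProduct_eq_zero_inr`), the prime-to-`p` Euler characteristic
(`natCard_invariants_mul_natCard_two_eq`) and the discharged Kummer isotropy. NO named fact is used.

THIS FILE (generic: `E = W` an elliptic curve over a number field `K`, `p` prime, `v` a finite place):
* §1 `exists_zsmul_of_weilIsotropic_of_card_le` — if `#H¹(K_v, E[p]) ≤ p²`, a subgroup `I ≤ H¹(K_v, E[p])` isotropic
  for the local Weil cup product is a LINE through any of its non-zero elements (`y ∈ ℤ·z`): were `y, z` independent
  they would span all of `H¹(K_v, E[p])` (counting), making `z` orthogonal to everything — local Tate duality.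
* §2 `natCard_galoisCohomology_one_torsion_le_sq` — `#H¹(K_v, E[p]) ≤ p²` as soon as `#E[p]^{Γ_{K_v}} ≤ p` and
  `v ∤ p`: `#H¹ = #H⁰ · #H²` (prime-to-`p` Euler characteristic, PROVED in the tree) and `#H² = #H⁰` (local duality
  `(2,0)` + Weil pairing, tree `natCard_galoisCohomology_two_torsion_restrictField`).
* §3 `weilCupProduct_localization_eq_zero_of_forall_ne`, `exists_zsmul_localization_of_forall_ne` (`K` TOTALLY
  COMPLEX, `K : Type`): for a subgroup `A ≤ H¹(K, E[p])` whose members have pairwise vanishing local Weil terms at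
  every place `w ≠ v`, the terms at `v` vanish too (Poitou–Tate: `∑_w inv_w(loc_w y ∪ loc_w z) = 0`, `inv_v`
  injective) — so by §1 the image of `A` at `v` is a line.
* §4 `exists_addMonoidHom_comp_localization_eq_torsionLocMap` — the two models of `H¹(K_v, E[n])` used by the
  skeleton: an additive `Φ : H¹(Γ_v, E[n](K̄)|Γ_v) → H¹(Γ_v, E(K̄_v)[n])` with `Φ ∘ loc_v = torsionLocMap`
  (change of coefficients along the torsion comparison `torsionPointsMap`; cocycle-level identity).

HONEST FRAMING: theorems only; no definition, no named fact, no `sorry`; nothing about Heegner points or level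
raising; closes nothing by itself (T7). PARTITION: O2@3 (B10) × A1 × crux 19574 — types-the-object-of (kernel
discharge of the GLOBAL input of a registered stub); closes: none.

References: [cite: MilneADT2006, Ch. I, Cor. 2.3, Thm. 2.8, Thm. 4.10(b)] [cite: WZhang2014, Prop. 5.4, §9 (9.1)–(9.3)]
[cite: BertoliniDarmon2005, §2.2–§2.3] [cite: CasselsFrohlichANT1967, Ch. VII §11] [cite: PoonenRains2012, Prop. 4.10].
-/

noncomputable section

open scoped Classical

universe u

namespace Summit.BirchSwinnertonDyer.Rank1Residual.X11b.Three.Koly.Method2.Iso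

open CategoryTheory WeierstrassCurve Field Function NumberField IsDedekindDomain ValuativeRel
  IsNonarchimedeanLocalField
open Literature.NumberTheory.EllipticCurves Literature.NumberTheory.EllipticCurves.ModularForms
  Literature.NumberTheory.GaloisRepresentations Module
open Literature.NumberTheory.GaloisRepresentations.DiscreteGaloisModule (mu MuCarrier)
open Literature.NumberTheory.GaloisCohomology
open scoped ContRepresentation

-- Cup products need `LocallyCompactSpace Γ`; as in the tree's cup-product files, the compactness of
-- absolute Galois groups is a local instance only; `E[n]` finite for the Tate-dual bookkeeping.
attribute [local instance] absoluteGaloisGroup_compactSpace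
attribute [local instance] finite_geomTorsion_of_neZero

/-! ## §1. An isotropic subgroup of `H¹(K_v, E[p])` is a line when `#H¹(K_v, E[p]) ≤ p²` -/

section Cyclic

variable {K : Type u} [Field K] [NumberField K] (W : WeierstrassCurve K) (p : ℕ) [Fact p.Prime]
  [W.IsElliptic]
variable (e : geomTorsion W p → geomTorsion W p → AlgebraicClosure K)
  (hμ : ∀ S T, e S T ^ p = 1)
  (hadd₁ : ∀ S₁ S₂ T, e (S₁ + S₂) T = e S₁ T * e S₂ T)
  (hadd₂ : ∀ S T₁ T₂, e S (T₁ + T₂) = e S T₁ * e S T₂)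
  (hgal : ∀ (σ : absoluteGaloisGroup K) (S T : geomTorsion W p), σ • e S T = e (σ • S) (σ • T))
variable (v : HeightOneSpectrum (𝓞 K))

/-- **An isotropic subgroup of `H¹(K_v, E[p])` is a line, when `#H¹(K_v, E[p]) ≤ p²`.** For a prime `p`, an
elliptic curve `E = W` over a number field `K`, a finite place `v`, a non-degenerate `Γ_K`-equivariant biadditive
`μ_p`-valued `e` on `E[p]` (a Weil pairing) and a subgroup `I ≤ H¹(K_v, E[p])` on which the local Weil cup product
vanishes identically: if `#H¹(K_v, E[p]) ≤ p²` then every `y ∈ I` is an integer multiple of any non-zero `z ∈ I`.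
Proof: otherwise `(a, b) ↦ a•y + b•z` is an injective map `𝔽_p² → H¹(K_v, E[p])`, hence bijective by counting, so
`z ∪ₑ t = 0` for ALL `t`, and `z = 0` by local Tate duality for `E[p]` (tree
`eq_zero_of_forall_weilCupProduct_eq_zero_inr`). This is the linear-algebra half of W. Zhang's Prop. 5.4 ∕ the
Poitou–Tate see-saw of koly MEMO-v8 §5 (`I = I^⊥` in the hyperbolic plane). [cite: MilneADT2006, Ch. I, Cor. 2.3]
[cite: WZhang2014, Prop. 5.4] -/
theorem exists_zsmul_of_weilIsotropic_of_card_le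
    (hnondeg : ∀ T, (∀ S, e S T = 1) → T = 0)
    (hcard : Nat.card (galoisCohomology ((W.torsionGaloisModule p).toLocal (Sum.inr v)) 1) ≤ p ^ 2)
    (I : AddSubgroup (galoisCohomology ((W.torsionGaloisModule p).toLocal (Sum.inr v)) 1))
    (hiso : ∀ x ∈ I, ∀ y ∈ I,
      (weilContPairingLocal W p e hμ hadd₁ hadd₂ hgal (Sum.inr v)).cupProduct x y = 0)
    {z : galoisCohomology ((W.torsionGaloisModule p).toLocal (Sum.inr v)) 1} (hz : z ∈ I)
    (hz0 : z ≠ 0)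
    {y : galoisCohomology ((W.torsionGaloisModule p).toLocal (Sum.inr v)) 1} (hy : y ∈ I) :
    ∃ a : ℤ, y = a • z := by
  have hp : p.Prime := Fact.out
  haveI : NeZero p := ⟨hp.ne_zero⟩
  -- `H¹(K_v, E[p])` is killed by `p`
  have hVp : ∀ x : (galoisCohomology ((W.torsionGaloisModule p).toLocal (Sum.inr v)) 1), p • x = 0 :=
    galoisCohomology.nsmul_eq_zero_of_forall _ (fun m => AddSubgroup.torsionBy.nsmul m)
  letI : Module (ZMod p) (galoisCohomology ((W.torsionGaloisModule p).toLocal (Sum.inr v)) 1) := AddCommGroup.zmodModule hVp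
  -- `H¹(K_v, E[p])` is finite
  haveI : Finite (galoisCohomology ((W.torsionGaloisModule p).toLocal (Sum.inr v)) 1) := by
    haveI : CharZero (v.adicCompletion K) := charZero_adicCompletion v
    exact finite_galoisCohomology_one_torsion_restrictField W p (v.adicCompletion K)
  by_contra hne
  push Not at hne
  -- a `ZMod p`-multiple is an integer multiple
  have hzmod : ∀ (c : ZMod p) (x : (galoisCohomology ((W.torsionGaloisModule p).toLocal (Sum.inr v)) 1)),
      c • x = c.val • x := fun c x => by
    conv_lhs => rw [← ZMod.natCast_zmod_val c]
    rw [Nat.cast_smul_eq_nsmul]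
  -- `y` and `z` are independent
  have hker : ∀ a b : ZMod p, a • y + b • z = 0 → a = 0 ∧ b = 0 := by
    intro a b hab
    by_cases ha : a = 0
    · subst ha
      rw [zero_smul, zero_add] at hab
      by_cases hb : b = 0
      · exact ⟨rfl, hb⟩
      · exfalso
        apply hz0
        have : b⁻¹ • (b • z) = 0 := by rw [hab, smul_zero]
        rwa [← mul_smul, inv_mul_cancel₀ hb, one_smul] at this
    · exfalso
      have hy' : y = (-(a⁻¹ * b)) • z := by
        have h1 : a⁻¹ • (a • y + b • z) = 0 := by rw [hab, smul_zero]
        rw [smul_add, ← mul_smul, ← mul_smul, inv_mul_cancel₀ ha, one_smul] at h1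
        rw [neg_smul, eq_neg_iff_add_eq_zero, h1]
      exact hne _ ((hy'.trans (hzmod _ z)).trans (natCast_zsmul z _).symm)
  -- the map `(a, b) ↦ a • y + b • z` is injective, hence bijective by counting
  let f : ZMod p × ZMod p → (galoisCohomology ((W.torsionGaloisModule p).toLocal (Sum.inr v)) 1) := fun ab => ab.1 • y + ab.2 • z
  have hf : ∀ ab : ZMod p × ZMod p, f ab = ab.1 • y + ab.2 • z := fun ab => rfl
  have hfinj : Function.Injective f := by
    rintro ⟨a, b⟩ ⟨a', b'⟩ hab
    rw [hf, hf] at hab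
    change a • y + b • z = a' • y + b' • z at hab
    have h0 : (a - a') • y + (b - b') • z = 0 := by
      rw [sub_smul, sub_smul, sub_add_sub_comm, hab, sub_self]
    obtain ⟨h1, h2⟩ := hker _ _ h0
    rw [sub_eq_zero] at h1 h2
    rw [h1, h2]
  have hcard' : Nat.card (galoisCohomology ((W.torsionGaloisModule p).toLocal (Sum.inr v)) 1) ≤ Nat.card (ZMod p × ZMod p) := by
    rw [Nat.card_prod, Nat.card_zmod, ← sq]
    exact hcard
  have hfbij : Function.Bijective f := hfinj.bijective_of_nat_card_le hcard'
  -- every class is `a • y + b • z`, so `z` pairs to zero with everything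
  have hzV : ∀ t : (galoisCohomology ((W.torsionGaloisModule p).toLocal (Sum.inr v)) 1), (weilContPairingLocal W p e hμ hadd₁ hadd₂ hgal (Sum.inr v)).cupProduct z t = 0 := by
    intro t
    obtain ⟨⟨a, b⟩, rfl⟩ := hfbij.2 t
    rw [hf]
    change (weilContPairingLocal W p e hμ hadd₁ hadd₂ hgal (Sum.inr v)).cupProduct z (a • y + b • z) = 0
    have hadd' : ∀ s t : (galoisCohomology ((W.torsionGaloisModule p).toLocal (Sum.inr v)) 1),
        (weilContPairingLocal W p e hμ hadd₁ hadd₂ hgal (Sum.inr v)).cupProduct z (s + t) =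
          (weilContPairingLocal W p e hμ hadd₁ hadd₂ hgal (Sum.inr v)).cupProduct z s +
            (weilContPairingLocal W p e hμ hadd₁ hadd₂ hgal (Sum.inr v)).cupProduct z t :=
      fun s t => map_add _ s t
    have hns' : ∀ (k : ℕ) (s : (galoisCohomology ((W.torsionGaloisModule p).toLocal (Sum.inr v)) 1)),
        (weilContPairingLocal W p e hμ hadd₁ hadd₂ hgal (Sum.inr v)).cupProduct z (k • s) =
          k • (weilContPairingLocal W p e hμ hadd₁ hadd₂ hgal (Sum.inr v)).cupProduct z s :=
      fun k s => map_nsmul _ k s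
    rw [hzmod a y, hzmod b z, hadd', hns', hns', hiso z hz y hy, hiso z hz z hz, nsmul_zero, nsmul_zero,
      add_zero]
  exact hz0 (eq_zero_of_forall_weilCupProduct_eq_zero_inr W p e hμ hadd₁ hadd₂ v hgal hnondeg z hzV)

end Cyclic

/-! ## §2. `#H¹(K_v, E[p]) ≤ p²` at `v ∤ p` when `#E[p]^{Γ_{K_v}} ≤ p` (prime-to-`p` Euler characteristic) -/

section Card

variable {K : Type u} [Field K] [NumberField K]

/-- The residue characteristic of `K_v` is not `p` when `v ∤ p` (a private copy of the tree's
`ringChar_residueField_adicCompletion_ne`, file `ZpExtensionUnramifiedProofs`, whose imports are not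
wanted here): `p` is a `v`-adic unit. [folklore] -/
private theorem ringChar_residueField_adicCompletion_ne' (v : HeightOneSpectrum (𝓞 K)) {p : ℕ}
    (hpv : (p : 𝓞 K) ∉ v.asIdeal) : ringChar 𝓀[v.adicCompletion K] ≠ p := by
  intro h
  have h0 : ((p : ℕ) : 𝓀[v.adicCompletion K]) = 0 :=
    (ringChar.spec 𝓀[v.adicCompletion K] p).2 (h ▸ dvd_rfl)
  have h1 : ¬ IsUnit ((p : ℕ) : 𝒪[v.adicCompletion K]) := fun hu ↦ by
    have h' := hu.map (IsLocalRing.residue 𝒪[v.adicCompletion K])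
    rw [map_natCast] at h'
    exact h'.ne_zero h0
  rw [Valuation.Integer.not_isUnit_iff_valuation_lt_one] at h1
  have h2 : Valued.v (((p : ℕ) : 𝒪[v.adicCompletion K]) : v.adicCompletion K) < 1 :=
    (Valuation.vlt_one_iff (Valued.v : Valuation (v.adicCompletion K) (WithZero (Multiplicative ℤ)))).mp
      ((Valuation.vlt_one_iff (ValuativeRel.valuation (v.adicCompletion K))).mpr h1)
  have h3 : (((p : ℕ) : 𝒪[v.adicCompletion K]) : v.adicCompletion K) =
      ((algebraMap (𝓞 K) K p : K) : v.adicCompletion K) := by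
    rw [SubringClass.coe_natCast, map_natCast]
    exact (map_natCast (algebraMap K (v.adicCompletion K)) p).symm
  rw [h3, HeightOneSpectrum.valuedAdicCompletion_eq_valuation', HeightOneSpectrum.valuation_lt_one_iff_mem] at h2
  exact hpv h2

variable (W : WeierstrassCurve K) (p : ℕ) [Fact p.Prime] [W.IsElliptic]

/-- **`#H¹(K_v, E[p]) ≤ p²` when `h⁰(K_v, E[p]) ≤ 1` and `v ∤ p`.** For a prime `p`, a finite place `v ∤ p` and
`#(E[p](K̄)|_{Γ_{K_v}})^{Γ_{K_v}} ≤ p`: `#H¹(K_v, E[p]) = #H⁰ · #H²` by the prime-to-`p` case of Tate's local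
Euler–Poincaré characteristic (PROVED in the tree: `natCard_invariants_mul_natCard_two_eq`, Milne I Thm. 2.8 ∕
Lemma 2.9) and `#H²(K_v, E[p]) = #E(K_v)[p] = #H⁰` (tree `natCard_galoisCohomology_two_torsion_restrictField`,
local duality in bidegree `(2,0)` + the Weil pairing); so `#H¹ = (#H⁰)² ≤ p²`. At a GOOD unipotent-admissible prime
of the method skeleton (`Frob_v = u²`, `u ≠ 1` unipotent) `h⁰ = 1` and this is the hyperbolic PLANE of koly MEMO-v8
§2. [cite: MilneADT2006, Ch. I §2, Thm. 2.8 and Lemma 2.9] -/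
theorem natCard_galoisCohomology_one_torsion_le_sq (v : HeightOneSpectrum (𝓞 K))
    (hpv : (p : 𝓞 K) ∉ v.asIdeal)
    (hH : Nat.card (GaloisRep.restrictField (v.adicCompletion K)
      (W.torsionGaloisModule p)).toTopRep.ρ.invariants ≤ p) :
    Nat.card (galoisCohomology ((W.torsionGaloisModule p).toLocal (Sum.inr v)) 1) ≤ p ^ 2 := by
  have hp : p.Prime := Fact.out
  haveI : NeZero p := ⟨hp.ne_zero⟩
  haveI : CharZero (v.adicCompletion K) := charZero_adicCompletion v
  have hA : IsPrimaryTorsion p (geomTorsion W p) :=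
    IsPrimaryTorsion.of_forall_nsmul_eq_zero (r := 1) fun m => by
      rw [pow_one]; exact AddSubgroup.torsionBy.nsmul m
  obtain ⟨-, h12⟩ := natCard_invariants_mul_natCard_two_eq (v.adicCompletion K)
    (GaloisRep.restrictField (v.adicCompletion K) (W.torsionGaloisModule p) :
      ContinuousRep (absoluteGaloisGroup (v.adicCompletion K)) ℤ (geomTorsion W p)) hA
    (ringChar_residueField_adicCompletion_ne' v hpv).symm
  have h12' : Nat.card (GaloisRep.restrictField (v.adicCompletion K)
        (W.torsionGaloisModule p)).toTopRep.ρ.invariants *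
      Nat.card (galoisCohomology (GaloisRep.restrictField (v.adicCompletion K)
        (W.torsionGaloisModule p)) 2) =
      Nat.card (galoisCohomology ((W.torsionGaloisModule p).toLocal (Sum.inr v)) 1) := h12
  rw [(natCard_galoisCohomology_two_torsion_restrictField W (v.adicCompletion K) p hp.isPrimePow).2,
    ← natCard_invariants_torsion_restrictField W (v.adicCompletion K) hp.ne_zero] at h12'
  rw [← h12', sq]
  exact Nat.mul_le_mul hH hH

end Card

/-! ## §3. Poitou–Tate: the image at `v` of a subgroup orthogonal away from `v` is isotropic, hence a line -/

section PoitouTate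

variable {K : Type} [Field K] [NumberField K] [IsTotallyComplex K] (W : WeierstrassCurve K) (p : ℕ)
  [Fact p.Prime] [W.IsElliptic]
variable (e : geomTorsion W p → geomTorsion W p → AlgebraicClosure K)
  (hμ : ∀ S T, e S T ^ p = 1)
  (hadd₁ : ∀ S₁ S₂ T, e (S₁ + S₂) T = e S₁ T * e S₂ T)
  (hadd₂ : ∀ S T₁ T₂, e S (T₁ + T₂) = e S T₁ * e S T₂)
  (hgal : ∀ (σ : absoluteGaloisGroup K) (S T : geomTorsion W p), σ • e S T = e (σ • S) (σ • T))
variable (v : HeightOneSpectrum (𝓞 K))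

/-- **Poitou–Tate see-saw, isotropy half: the local Weil terms at `v` vanish on a subgroup whose terms vanish at
every other place.** `K` a TOTALLY COMPLEX number field (`K : Type`), `A ≤ H¹(K, E[p])` a subgroup such that for all
`y, z ∈ A` and every place `w ≠ v` the local Weil cup product `loc_w y ∪ₑ loc_w z` vanishes; then
`loc_v y ∪ₑ loc_v z = 0` for all `y, z ∈ A`. Proof: Tate's reciprocity law `∑_w inv_w(loc_w y ∪ₑ loc_w z) = 0`
(tree THEOREM `poitouTate_sum_localTatePairing_eq_zero_of_isTotallyComplex`, transported to the Weil cup product by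
`sum_inv_weilCupProduct_localization_eq_zero`) with `S = {v}`, and `inv_v` is injective (`LocalInvariants.IsPerfect`).
This is "`im(Sel_{F^v}) ⊥ im(Sel_{F^v})`", the easy inclusion of Milne I Thm. 4.10 ∕ Mazur–Rubin Thm. 2.3.4 used by
W. Zhang Prop. 5.4 (koly MEMO-v8 §5 (I4)). [cite: MilneADT2006, Ch. I, Thm. 4.10(b)] [cite: WZhang2014, Prop. 5.4]
[cite: CasselsFrohlichANT1967, Ch. VII §11] -/
theorem weilCupProduct_localization_eq_zero_of_forall_ne (A : AddSubgroup (galH1Torsion W (p : ℤ)))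
    (hA : ∀ y ∈ A, ∀ z ∈ A, ∀ w : Place K, w ≠ Sum.inr v →
      (weilContPairingLocal W p e hμ hadd₁ hadd₂ hgal w).cupProduct
        (galoisCohomology.localization (W.torsionGaloisModule p) w 1 y)
        (galoisCohomology.localization (W.torsionGaloisModule p) w 1 z) = 0)
    {y z : galH1Torsion W (p : ℤ)} (hy : y ∈ A) (hz : z ∈ A) :
    (weilContPairingLocal W p e hμ hadd₁ hadd₂ hgal (Sum.inr v)).cupProduct
      (galoisCohomology.localization (W.torsionGaloisModule p) (Sum.inr v) 1 y)
      (galoisCohomology.localization (W.torsionGaloisModule p) (Sum.inr v) 1 z) = 0 := by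
  have hp : p.Prime := Fact.out
  haveI : NeZero p := ⟨hp.ne_zero⟩
  obtain ⟨inv, hperf, hPT⟩ := poitouTate_sum_localTatePairing_eq_zero_of_isTotallyComplex K p
  have h := sum_inv_weilCupProduct_localization_eq_zero W p e hμ hadd₁ hadd₂ hgal inv hPT y z
    {Sum.inr v} (fun w hw => by
      rw [hA y hy z hz w (by simpa using hw)]
      exact map_zero (inv w))
  rw [Finset.sum_singleton] at h
  have hinj : Function.Injective (inv (Sum.inr v)) := (hperf v).1.1
  exact hinj (h.trans (map_zero _).symm)

/-- **Poitou–Tate see-saw: the image at `v` of a subgroup orthogonal away from `v` is a LINE** (`K` totally complex,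
`#H¹(K_v, E[p]) ≤ p²`): for `y, z ∈ A` with `loc_v z ≠ 0`, `loc_v y = a • loc_v z` for some `a ∈ ℤ`
(`weilCupProduct_localization_eq_zero_of_forall_ne` + `exists_zsmul_of_weilIsotropic_of_card_le`). This is the shape
of the input (Iso) of the method skeleton's rank-lowering stub (koly3a `selQ_rankLowering_on_of_localGlobal`), in the
`galoisCohomology.localization` model. [cite: WZhang2014, Prop. 5.4, §9 (9.1)–(9.2)] [cite: MilneADT2006, Ch. I, Thm. 4.10(b)] -/
theorem exists_zsmul_localization_of_forall_ne (hnondeg : ∀ T, (∀ S, e S T = 1) → T = 0)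
    (hcard : Nat.card (galoisCohomology ((W.torsionGaloisModule p).toLocal (Sum.inr v)) 1) ≤ p ^ 2)
    (A : AddSubgroup (galH1Torsion W (p : ℤ)))
    (hA : ∀ y ∈ A, ∀ z ∈ A, ∀ w : Place K, w ≠ Sum.inr v →
      (weilContPairingLocal W p e hμ hadd₁ hadd₂ hgal w).cupProduct
        (galoisCohomology.localization (W.torsionGaloisModule p) w 1 y)
        (galoisCohomology.localization (W.torsionGaloisModule p) w 1 z) = 0)
    {y z : galH1Torsion W (p : ℤ)} (hy : y ∈ A) (hz : z ∈ A)
    (hz0 : galoisCohomology.localization (W.torsionGaloisModule p) (Sum.inr v) 1 z ≠ 0) :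
    ∃ a : ℤ, galoisCohomology.localization (W.torsionGaloisModule p) (Sum.inr v) 1 y =
      a • galoisCohomology.localization (W.torsionGaloisModule p) (Sum.inr v) 1 z := by
  refine exists_zsmul_of_weilIsotropic_of_card_le W p e hμ hadd₁ hadd₂ hgal v hnondeg hcard
    (A.map (galoisCohomology.localization (W.torsionGaloisModule p) (Sum.inr v) 1)) ?_
    (AddSubgroup.mem_map_of_mem _ hz) hz0 (AddSubgroup.mem_map_of_mem _ hy)
  rintro _ ⟨y', hy', rfl⟩ _ ⟨z', hz', rfl⟩
  exact weilCupProduct_localization_eq_zero_of_forall_ne W p e hμ hadd₁ hadd₂ hgal v A hA hy' hz'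

end PoitouTate

/-! ## §4. The two models of `H¹(K_v, E[n])`: a comparison map `Φ` with `Φ ∘ loc_v = torsionLocMap` -/

section Comparison

variable {K : Type} [Field K] [NumberField K] (W : WeierstrassCurve K) (n : ℕ)
variable (v : HeightOneSpectrum (𝓞 K))

/-- **The two models of `H¹(K_v, E[n])` agree along an additive comparison map.** The tree has two localisations of
`H¹(K, E[n])` at a finite place `v`: `galoisCohomology.localization` into `H¹(Γ_{K_v}, E[n](K̄)|_{Γ_{K_v}})` (restricted
coefficients; where Poitou–Tate, local duality and the Kummer Selmer structure live) and `WeierstrassCurve.torsionLocMap`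
into `H¹(Γ_{K_v}, E(K̄_v)[n])` (local points; where `torsionLocalKer`, `ordinaryLocalKer` and the method skeleton's
stubs live). There is an additive `Φ` — change of coefficients along the torsion comparison `torsionPointsMap :
E[n](K̄) → E(K̄_v)[n]` (Mathlib `ContinuousCohomology.map` along `(id, θ)`) — with `Φ (loc_v x) = torsionLocMap x`
for every `x` (both are the class of `σ ↦ θ(φ(res σ))`; `map_oneCocycleClass`). Stated as an existence so that no
definition is introduced. Serre, *Galois Cohomology*, I.§2.4 (compatible pairs). [folklore] -/
theorem exists_addMonoidHom_comp_localization_eq_torsionLocMap :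
    ∃ Φ : galoisCohomology ((W.torsionGaloisModule n).toLocal (Sum.inr v)) 1 →+
        discreteH1 (absoluteGaloisGroup (v.adicCompletion K))
          (AddSubgroup.torsionBy (localPoints W (v.adicCompletion K)) (n : ℤ)),
      ∀ x : galH1Torsion W (n : ℤ),
        Φ (galoisCohomology.localization (W.torsionGaloisModule n) (Sum.inr v) 1 x) =
          W.torsionLocMap (v.adicCompletion K) (n : ℤ) x := by
  let f : TopRep.res ((ContinuousMonoidHom.id (absoluteGaloisGroup (v.adicCompletion K))) :
        absoluteGaloisGroup (v.adicCompletion K) →* absoluteGaloisGroup (v.adicCompletion K))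
      (DiscreteGaloisModule.toTopRep (GaloisRep.restrictField (v.adicCompletion K)
        (W.torsionGaloisModule (n : ℤ)))) ⟶
      discreteTopRep (absoluteGaloisGroup (v.adicCompletion K))
        (AddSubgroup.torsionBy (localPoints W (v.adicCompletion K)) (n : ℤ)) :=
    TopRep.ofHom
      { toLinearMap := (torsionPointsMap W (v.adicCompletion K) (n : ℤ)).toIntLinearMap
        cont := continuous_of_discreteTopology
        isIntertwining' := fun x ↦ ContinuousLinearMap.ext fun m ↦
          torsionPointsMap_smul W (v.adicCompletion K) _ x m }
  refine ⟨(ContinuousCohomology.map (ContinuousMonoidHom.id _) f 1).hom.toLinearMap.toAddMonoidHom,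
    fun x ↦ ?_⟩
  obtain ⟨φ, rfl⟩ := oneCocycleClass_surjective
    (discreteTopRep (absoluteGaloisGroup K) (geomTorsion W (n : ℤ))) x
  change (ContinuousCohomology.map _ f 1).hom (galoisCohomology.res (W.torsionGaloisModule (n : ℤ))
    (v.adicCompletion K) 1 (oneCocycleClass (discreteTopRep (absoluteGaloisGroup K)
      (geomTorsion W (n : ℤ))) φ)) = (ContinuousCohomology.map _ _ 1).hom (oneCocycleClass _ φ)
  rw [res_torsionGaloisModule_oneCocycleClass, map_oneCocycleClass, map_oneCocycleClass]
  rfl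

end Comparison

end Summit.BirchSwinnertonDyer.Rank1Residual.X11b.Three.Koly.Method2.Iso

end
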